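import Summits.BirchSwinnertonDyer.BirchSwinnertonDyer.Theorems.GenusKolyvaginAtTwoMinimalTwinBSDTwoOddManinDatum
import HarnessLib

/-!
# Route `GenusKolyvaginAtTwo`, crux U₂ `MinimalTwinBSDTwo` (stmt-BirchSwinnertonDyer-22985), LINE 23 «twin_swap» — THE MANIN STUB PINNED:
# the `2`-adic valuation of the Manin constant of ANY parametrisation datum of an `E[2]`-irreducible curve is at least that of the optimal
# (strong Weil) datum of its isogeny class, with equality attained; hence «some datum of `W` has odd Manin constant» ⟺ «the optimal
# Manin constant `c₀` of the class is odd»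

Seat `bsd-line-gk2-p2` g37 (PROVER seat 2/3, cell `bsd-f1-sign2`, LINE 23 holder), `--supports stmt-BirchSwinnertonDyer-22985 --as helper`.
THEOREMS ONLY (no definition, no named fact, no `sorry`); UNCONDITIONAL (every input is a tree theorem).  BSD is NOT proved by any of this;
U₂ is NOT proved; nothing is closed.

WHY.  The registered stub MANIN|₄ of LINE 23 v2.13.1 (`TwinSwapV213.stub_oddCutManinResidue : OddCutManinResidueAtTwo`) asks, for every `W`
on the odd habitat cut with `4 ∣ N_W`, for SOME modular parametrisation datum `Dt : ModularParametrizationData W N_W` with `Odd Dt.c`.  Since the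
Manin constant `c` of a datum is only constrained by `c·Λ_f ⊆ Λ_W` (and every non-zero multiple of an admissible `c` is admissible,
`ModularParametrizationData.exists_datum_c_eq`), one may hope that a NON-optimal parametrisation of `W` has odd `c` even when the strong Weil
curve's Manin constant `c₀` is even.  This file closes that door: for `E[2]`-irreducible `W` (the cut: `ρ̄_{W,2}` onto) the admissible Manin
constants of `W` are, `2`-adically, exactly the multiples of `c₀`.  So MANIN|₄ IS Manin's conjecture modulo `2` for the optimal curves of the
classes on the `v₂(N) ≥ 2` sub-cell — nothing weaker, nothing stronger (g33's p816794 gave the sufficiency on `4 ∤ N` through Abbes–Ullmo /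
Česnavičius; here both directions, level-free, print-free).

MECHANISM (Silverman AEC VI.4.1 (b), III.4.11, III.5; Edixhoven 1991 Prop. 2; all tree theorems).  `Dt` on `W`: `c·Λ_f ⊆ Λ_W`.  `(W₀, D₀)` optimal
in the class: `Λ_{W₀} = c₀·Λ_f` (same newform `f`: `IsNewformOf.of_isIsogenous` + `IsNewformOf.unique`).  `E[2]` irreducible ⟹ an isogeny
`ψ : W → W₀` of ODD degree `d` (`SkinnerUrban2014.exists_isogeny_not_dvd_degree_of_irreducible`), acting on the Néron lattices as `z ↦ rz`,
`rΛ_W ⊆ Λ_{W₀}` of index `d` (`exists_rat_mulLeft_lattice_le_of_isogeny`), `r ∈ ℤ` and `μ := d/r ∈ ℤ` by Néron integrality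
(`integral_neronScaling_of_isGloballyMinimal_holds`), `rμ = d` odd ⟹ `r, μ` odd.  Then `γ := r·c/c₀ ∈ ℚ` maps `Λ_{W₀}` into itself
(`z = c₀w ↦ r·(c w) ∈ rΛ_W ⊆ Λ_{W₀}`), so `γ ∈ ℤ` (`int_of_rat_mul_mem_lattice_self`): **`c₀ ∣ r·c` with `r` odd**, whence `v₂(c₀) ≤ v₂(c)` and
`c` odd ⟹ `c₀` odd.  Conversely `k := μ·c₀` has `kΛ_f = μΛ_{W₀} ⊆ Λ_W` (from `dΛ_{W₀} ⊆ rΛ_W`), a datum of `W` with `v₂(k) = v₂(c₀)`.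

* §1 `optimal_c_dvd_odd_mul_c` (★ `c₀ ∣ r·c`, `r` odd), `odd_optimal_c_of_odd_c`, `padicValInt_two_optimal_c_le`.
* §2 `exists_datum_c_eq_odd_mul_of_isIsogenous` (a datum of `W` with `c = μ·c'`, `μ` odd, for ANY datum `D'` of ANY isogenous globally minimal
  `W'` — optimality not needed; same newform / period pair / uniformisation as the given datum of `W`), `exists_datum_odd_c_of_isIsogenous_odd_c`,
  `exists_datum_padicValInt_two_c_eq_of_isIsogenous`.
* §3 `exists_datum_odd_c_iff_odd_optimal_c` (★★ the pin) and `isLeast_padicValInt_two_c_optimal` (the least `v₂` of a Manin constant of `W` is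
  `v₂(c₀)`).
* §4 in LINE 23's currency, per curve: `exists_datum_odd_c_conductor_iff_forall_optimal_odd` — on the cut's image hypothesis (`ρ_{W,2^n}` onto),
  «`W` has a datum at level `N_W` with odd `c`» (the `W`-instance of MANIN|₄ `OddCutManinResidueAtTwo`) ⟺ «every globally minimal lattice-optimal
  datum of `W`'s class at level `N_W` has odd `c₀`» (modulo `nonempty_modularParametrizationData`, which supplies a datum of `W` to transport; the
  optimal data exist by Edixhoven, tree theorem); and the same in U₂'s own hypotheses (`r_an = 1`, `#Sel₂ = 2`; + GZK).

HONEST FRAMING.  Nothing here touches Manin's conjecture itself (open in print at `v₂(N) ≥ 2`: Česnavičius–Neururer–Saha 2022 give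
`v₂(c_φ) ≤ v₂(deg φ) (+1)`, not oddness); the file only identifies WHICH statement the stub is.  BSD is NOT proved.

References: [SilvermanAEC2009] Thm. VI.4.1 (b), Cor. III.4.11, §III.5; [EdixhovenManin1991] Prop. 2; [AgasheRibetStein2006] Thm. 2.2, §2;
[GreenbergVatsal2000] §3 Rem. 3.4; [CesnaviciusNeururerSaha2022] Thm. 1.2 (arXiv:1911.09446, the `p = 2` clause).
-/

set_option autoImplicit false
set_option linter.dupNamespace false -- `Summit.<P>.<Sub>` repeats `BirchSwinnertonDyer` (D-0017)

noncomputable section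

open scoped Classical MatrixGroups ModularForm

namespace Summit.BirchSwinnertonDyer.BirchSwinnertonDyer.Theorems.GenusExact.TwinSwap.OddManin

open Literature.NumberTheory.EllipticCurves WeierstrassCurve CongruenceSubgroup
  Literature.NumberTheory.EllipticCurves.ModularForms

/-! ## §1 The optimal Manin constant divides an odd multiple of every Manin constant of the class -/

/-- **`c₀ ∣ r·c` with `r` odd.**  `W/ℚ` globally minimal elliptic with `E[2]` irreducible, `Dt` a modular parametrisation datum of `W` at level
`N`; `W₀/ℚ` globally minimal, `ℚ`-isogenous to `W`, with a LATTICE-OPTIMAL datum `D₀` at level `N` (`Λ_{W₀} ⊆ c₀Λ_f`, hence `= c₀Λ_f`: `W₀` is a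
minimal model of the strong Weil curve and `c₀ = D₀.c` its Manin constant).  Then `D₀.c ∣ r * Dt.c` for some ODD integer `r` (the Néron scalar
of an odd-degree isogeny `W → W₀`).  Unconditional. [cite: SilvermanAEC2009, Thm. VI.4.1 (b), Cor. III.4.11] [cite: EdixhovenManin1991, Prop. 2]
[cite: GreenbergVatsal2000, §3, Remark 3.4] -/
theorem optimal_c_dvd_odd_mul_c
    (W : WeierstrassCurve ℚ) [W.IsElliptic] [W.IsGloballyMinimal] (hirr : W.HasIrreducibleModPGaloisRep 2)
    {N : ℕ} [NeZero N] (Dt : ModularParametrizationData W N)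
    (W₀ : WeierstrassCurve ℚ) [W₀.IsElliptic] [W₀.IsGloballyMinimal] (D₀ : ModularParametrizationData W₀ N)
    (hiso : W.IsIsogenous W₀) (hopt : ∀ z ∈ D₀.L.lattice, ∃ w ∈ periodLattice D₀.f, z = (D₀.c : ℂ) * w) :
    ∃ r : ℤ, Odd r ∧ D₀.c ∣ r * Dt.c := by
  -- the two data carry the same newform
  have hf : Dt.f = D₀.f := Dt.isNewformOf.unique (D₀.isNewformOf.of_isIsogenous hiso)
  -- an isogeny `W → W₀` of odd degree `d`, acting on the Néron lattices as `z ↦ rz`, `rΛ_W ⊆ Λ_{W₀}` of index `d`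
  obtain ⟨ψ, hψ⟩ := SkinnerUrban2014.exists_isogeny_not_dvd_degree_of_irreducible (p := 2) (W := W) (W' := W₀)
    (by norm_num) hirr hiso
  obtain ⟨r, hr0, hle, hidx⟩ := exists_rat_mulLeft_lattice_le_of_isogeny W W₀ Dt.isNeronLattice D₀.isNeronLattice ψ
  set d : ℕ := ψ.degree with hd
  have hmem : ∀ z ∈ Dt.L.lattice, ((r : ℚ) : ℂ) * z ∈ D₀.L.lattice := fun z hz ↦
    hle (PeriodPair.mul_mem_mulLeft_lattice.mpr hz)
  -- `r ∈ ℤ` (Néron integrality)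
  obtain ⟨q, hq⟩ := integral_neronScaling_of_isGloballyMinimal_holds W W₀ Dt.L D₀.L Dt.isNeronLattice D₀.isNeronLattice r hmem
  -- `dΛ_{W₀} ⊆ rΛ_W`, i.e. `(d/r)Λ_{W₀} ⊆ Λ_W`, and `μ := d/r ∈ ℤ`
  have hdmem : ∀ z ∈ D₀.L.lattice, ((d / r : ℚ) : ℂ) * z ∈ Dt.L.lattice := by
    intro z hz
    have h1 : d • z ∈ (Dt.L.mulLeft (r : ℂ) hr0).lattice := by
      have h2 := AddSubgroup.nsmul_relIndex_mem (Dt.L.mulLeft (r : ℂ) hr0).lattice.toAddSubgroup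
        (K := D₀.L.lattice.toAddSubgroup) (g := z) hz
      rw [hidx] at h2
      exact h2
    rw [PeriodPair.mem_mulLeft_lattice, nsmul_eq_mul] at h1
    have e : ((d / r : ℚ) : ℂ) * z = ((r : ℚ) : ℂ)⁻¹ * ((d : ℂ) * z) := by
      push_cast
      ring
    rw [e]
    exact h1
  obtain ⟨μ, hμ⟩ := integral_neronScaling_of_isGloballyMinimal_holds W₀ W D₀.L Dt.L D₀.isNeronLattice Dt.isNeronLattice (d / r) hdmem
  have hr0' : (r : ℚ) ≠ 0 := by
    rintro rfl
    exact hr0 (by push_cast; rfl)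
  have hqμ : q * μ = d := by
    have h : (q : ℚ) * μ = d := by
      rw [hq, hμ]
      field_simp
    exact_mod_cast h
  -- `d` odd, hence `q = r` odd
  have hdodd : Odd (d : ℤ) := by
    have : ¬ 2 ∣ d := hψ
    exact_mod_cast Nat.odd_iff.mpr (Nat.two_dvd_ne_zero.mp this)
  have hqodd : Odd q := by
    rw [← hqμ] at hdodd
    exact (Int.odd_mul.mp hdodd).1
  -- `γ := r·c/c₀` maps `Λ_{W₀}` into itself
  have hc₀ : D₀.c ≠ 0 := D₀.maninConstant_ne_zero_holds
  have hc₀C : (D₀.c : ℂ) ≠ 0 := by exact_mod_cast hc₀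
  have hγ : ∀ z ∈ D₀.L.lattice, (((q * Dt.c : ℤ) / D₀.c : ℚ) : ℂ) * z ∈ D₀.L.lattice := by
    intro z hz
    obtain ⟨w, hw, rfl⟩ := hopt z hz
    have hw' : w ∈ periodLattice Dt.f := by rw [hf]; exact hw
    have hcw : (Dt.c : ℂ) * w ∈ Dt.L.lattice := Dt.smul_periodLattice_le w hw'
    have h1 := hmem _ hcw
    have e : (((q * Dt.c : ℤ) / D₀.c : ℚ) : ℂ) * ((D₀.c : ℂ) * w) = ((r : ℚ) : ℂ) * ((Dt.c : ℂ) * w) := by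
      rw [← hq]
      push_cast
      field_simp
    rw [e]
    exact h1
  obtain ⟨k, hk⟩ := int_of_rat_mul_mem_lattice_self D₀.L _ hγ
  refine ⟨q, hqodd, k, ?_⟩
  have hc₀Q : (D₀.c : ℚ) ≠ 0 := by exact_mod_cast hc₀
  have h : (k : ℚ) * D₀.c = (q * Dt.c : ℤ) := by
    rw [hk]
    field_simp
  have h' : k * D₀.c = q * Dt.c := by exact_mod_cast h
  rw [← h', mul_comm]

/-- **An odd Manin constant anywhere in an `E[2]`-irreducible class forces the OPTIMAL Manin constant to be odd** (the necessity half of the pin):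
with `W, Dt, W₀, D₀` as in `optimal_c_dvd_odd_mul_c`, `Odd Dt.c → Odd D₀.c`.  Unconditional. [cite: SilvermanAEC2009, Thm. VI.4.1 (b)]
[cite: EdixhovenManin1991, Prop. 2] -/
theorem odd_optimal_c_of_odd_c
    (W : WeierstrassCurve ℚ) [W.IsElliptic] [W.IsGloballyMinimal] (hirr : W.HasIrreducibleModPGaloisRep 2)
    {N : ℕ} [NeZero N] (Dt : ModularParametrizationData W N) (hodd : Odd Dt.c)
    (W₀ : WeierstrassCurve ℚ) [W₀.IsElliptic] [W₀.IsGloballyMinimal] (D₀ : ModularParametrizationData W₀ N)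
    (hiso : W.IsIsogenous W₀) (hopt : ∀ z ∈ D₀.L.lattice, ∃ w ∈ periodLattice D₀.f, z = (D₀.c : ℂ) * w) :
    Odd D₀.c := by
  obtain ⟨r, hr, hdvd⟩ := optimal_c_dvd_odd_mul_c W hirr Dt W₀ D₀ hiso hopt
  rcases Int.even_or_odd D₀.c with h | h
  · exact absurd (even_iff_two_dvd.mpr ((even_iff_two_dvd.mp h).trans hdvd)) (Int.not_even_iff_odd.mpr (hr.mul hodd))
  · exact h

/-- **The optimal Manin constant has the LEAST `2`-adic valuation in an `E[2]`-irreducible class**: with `W, Dt, W₀, D₀` as in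
`optimal_c_dvd_odd_mul_c`, `v₂(D₀.c) ≤ v₂(Dt.c)`.  Unconditional. [cite: SilvermanAEC2009, Thm. VI.4.1 (b)] [cite: EdixhovenManin1991, Prop. 2] -/
theorem padicValInt_two_optimal_c_le
    (W : WeierstrassCurve ℚ) [W.IsElliptic] [W.IsGloballyMinimal] (hirr : W.HasIrreducibleModPGaloisRep 2)
    {N : ℕ} [NeZero N] (Dt : ModularParametrizationData W N)
    (W₀ : WeierstrassCurve ℚ) [W₀.IsElliptic] [W₀.IsGloballyMinimal] (D₀ : ModularParametrizationData W₀ N)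
    (hiso : W.IsIsogenous W₀) (hopt : ∀ z ∈ D₀.L.lattice, ∃ w ∈ periodLattice D₀.f, z = (D₀.c : ℂ) * w) :
    padicValInt 2 D₀.c ≤ padicValInt 2 Dt.c := by
  obtain ⟨r, hr, hdvd⟩ := optimal_c_dvd_odd_mul_c W hirr Dt W₀ D₀ hiso hopt
  have hc : Dt.c ≠ 0 := Dt.maninConstant_ne_zero_holds
  have hr0 : r ≠ 0 := by rintro rfl; exact (Int.not_even_iff_odd.mpr hr) ⟨0, by norm_num⟩
  have hr2 : padicValInt 2 r = 0 :=
    padicValInt.eq_zero_of_not_dvd fun h ↦ (Int.not_even_iff_odd.mpr hr) (even_iff_two_dvd.mpr (by exact_mod_cast h))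
  have h2 : ((2 : ℕ) : ℤ) ^ padicValInt 2 D₀.c ∣ r * Dt.c := (padicValInt_dvd D₀.c).trans hdvd
  rcases (padicValInt_dvd_iff _ _).mp h2 with h0 | hle
  · exact absurd h0 (mul_ne_zero hr0 hc)
  · rwa [padicValInt.mul hr0 hc, hr2, zero_add] at hle

/-! ## §2 Transport along an odd isogeny: a datum of `W` with `c = μ·c'`, `μ` odd (no optimality needed) -/

/-- **Transport of a Manin constant to `W` along an odd isogeny.**  `W/ℚ` globally minimal with `E[2]` irreducible and a datum `Dt` at level `N`;
`W'/ℚ` globally minimal, `ℚ`-isogenous to `W`, with ANY datum `D'` at level `N` (optimality NOT needed).  Then `W` carries a datum `Dk` at level `N`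
with the SAME newform, period pair and uniformisation as `Dt` and `Dk.c = μ * D'.c` for an ODD integer `μ` (`μ = d/r`: `d` the odd degree of an
isogeny `ψ : W → W'`, `r ∈ ℤ` its Néron scalar, `dΛ_{W'} ⊆ rΛ_W`, so `μ·(D'.c·Λ_f) ⊆ μΛ_{W'} ⊆ Λ_W`).  This is the mechanism of g33's
`exists_datum_odd_c_of_irreducible_two_of_not_four_dvd` (p816794) with the Abbes–Ullmo / Česnavičius input, the level hypothesis `4 ∤ N` and the
optimality of the source ALL removed: unconditional, any level. [cite: SilvermanAEC2009, Thm. VI.4.1 (b), Cor. III.4.11]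
[cite: EdixhovenManin1991, Prop. 2] [cite: GreenbergVatsal2000, §3, Remark 3.4] -/
theorem exists_datum_c_eq_odd_mul_of_isIsogenous
    (W : WeierstrassCurve ℚ) [W.IsElliptic] [W.IsGloballyMinimal] (hirr : W.HasIrreducibleModPGaloisRep 2)
    {N : ℕ} [NeZero N] (Dt : ModularParametrizationData W N)
    (W' : WeierstrassCurve ℚ) [W'.IsElliptic] [W'.IsGloballyMinimal] (D' : ModularParametrizationData W' N) (hiso : W.IsIsogenous W') :
    ∃ (Dk : ModularParametrizationData W N) (μ : ℤ), Dk.f = Dt.f ∧ Dk.L = Dt.L ∧ Dk.uniformize = Dt.uniformize ∧ Odd μ ∧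
      Dk.c = μ * D'.c := by
  have hf : Dt.f = D'.f := Dt.isNewformOf.unique (D'.isNewformOf.of_isIsogenous hiso)
  obtain ⟨ψ, hψ⟩ := SkinnerUrban2014.exists_isogeny_not_dvd_degree_of_irreducible (p := 2) (W := W) (W' := W')
    (by norm_num) hirr hiso
  obtain ⟨r, hr0, hle, hidx⟩ := exists_rat_mulLeft_lattice_le_of_isogeny W W' Dt.isNeronLattice D'.isNeronLattice ψ
  set d : ℕ := ψ.degree with hd
  have hmem : ∀ z ∈ Dt.L.lattice, ((r : ℚ) : ℂ) * z ∈ D'.L.lattice := fun z hz ↦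
    hle (PeriodPair.mul_mem_mulLeft_lattice.mpr hz)
  obtain ⟨q, hq⟩ := integral_neronScaling_of_isGloballyMinimal_holds W W' Dt.L D'.L Dt.isNeronLattice D'.isNeronLattice r hmem
  have hdmem : ∀ z ∈ D'.L.lattice, ((d / r : ℚ) : ℂ) * z ∈ Dt.L.lattice := by
    intro z hz
    have h1 : d • z ∈ (Dt.L.mulLeft (r : ℂ) hr0).lattice := by
      have h2 := AddSubgroup.nsmul_relIndex_mem (Dt.L.mulLeft (r : ℂ) hr0).lattice.toAddSubgroup
        (K := D'.L.lattice.toAddSubgroup) (g := z) hz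
      rw [hidx] at h2
      exact h2
    rw [PeriodPair.mem_mulLeft_lattice, nsmul_eq_mul] at h1
    have e : ((d / r : ℚ) : ℂ) * z = ((r : ℚ) : ℂ)⁻¹ * ((d : ℂ) * z) := by
      push_cast
      ring
    rw [e]
    exact h1
  obtain ⟨μ, hμ⟩ := integral_neronScaling_of_isGloballyMinimal_holds W' W D'.L Dt.L D'.isNeronLattice Dt.isNeronLattice (d / r) hdmem
  have hr0' : (r : ℚ) ≠ 0 := by
    rintro rfl
    exact hr0 (by push_cast; rfl)
  have hqμ : q * μ = d := by
    have h : (q : ℚ) * μ = d := by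
      rw [hq, hμ]
      field_simp
    exact_mod_cast h
  have hdodd : Odd (d : ℤ) := by
    have : ¬ 2 ∣ d := hψ
    exact_mod_cast Nat.odd_iff.mpr (Nat.two_dvd_ne_zero.mp this)
  have hμodd : Odd μ := by
    rw [← hqμ] at hdodd
    exact (Int.odd_mul.mp hdodd).2
  have hc' : D'.c ≠ 0 := D'.maninConstant_ne_zero_holds
  -- `k := μ c'` has `kΛ_f ⊆ Λ_W`
  have hk : ∀ z ∈ periodLattice Dt.f, ((μ * D'.c : ℤ) : ℂ) * z ∈ Dt.L.lattice := by
    intro z hz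
    have hz' : (D'.c : ℂ) * z ∈ D'.L.lattice := D'.smul_periodLattice_le z (hf ▸ hz)
    have h1 := hdmem _ hz'
    have e : ((μ * D'.c : ℤ) : ℂ) * z = ((d / r : ℚ) : ℂ) * ((D'.c : ℂ) * z) := by
      rw [← hμ]
      push_cast
      ring
    rw [e]
    exact h1
  have hk0 : μ * D'.c ≠ 0 := by
    refine mul_ne_zero ?_ hc'
    rintro rfl
    exact (Int.not_even_iff_odd.mpr hμodd) ⟨0, by norm_num⟩
  obtain ⟨Dk, hfk, hLk, huk, hck⟩ := Dt.exists_datum_c_eq hk0 hk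
  exact ⟨Dk, μ, hfk, hLk, huk, hμodd, hck⟩

/-- **An odd Manin constant anywhere in the class transports to `W`**: with `W` (`E[2]` irreducible, datum `Dt` at level `N`), `W'` globally minimal
isogenous with a datum `D'` at level `N` of ODD Manin constant, `W` has a datum at level `N` with odd Manin constant (same newform, period pair,
uniformisation as `Dt`).  Unconditional, ANY level — on `4 ∣ N` this is «Manin's conjecture mod `2` for the strong Weil curve ⟹ MANIN|₄ at `W`».
[cite: SilvermanAEC2009, Thm. VI.4.1 (b)] [cite: EdixhovenManin1991, Prop. 2] [cite: GreenbergVatsal2000, §3, Remark 3.4] -/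
theorem exists_datum_odd_c_of_isIsogenous_odd_c
    (W : WeierstrassCurve ℚ) [W.IsElliptic] [W.IsGloballyMinimal] (hirr : W.HasIrreducibleModPGaloisRep 2)
    {N : ℕ} [NeZero N] (Dt : ModularParametrizationData W N)
    (W' : WeierstrassCurve ℚ) [W'.IsElliptic] [W'.IsGloballyMinimal] (D' : ModularParametrizationData W' N) (hiso : W.IsIsogenous W')
    (hodd : Odd D'.c) :
    ∃ Dk : ModularParametrizationData W N, Dk.f = Dt.f ∧ Dk.L = Dt.L ∧ Dk.uniformize = Dt.uniformize ∧ Odd Dk.c := by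
  obtain ⟨Dk, μ, hfk, hLk, huk, hμ, hck⟩ := exists_datum_c_eq_odd_mul_of_isIsogenous W hirr Dt W' D' hiso
  exact ⟨Dk, hfk, hLk, huk, hck ▸ hμ.mul hodd⟩

/-- **Valuations transport**: `W` (`E[2]` irreducible) carries a datum at level `N` whose Manin constant has EXACTLY the `2`-adic valuation of any
given Manin constant `D'.c` of an isogenous globally minimal `W'`.  Unconditional. [cite: SilvermanAEC2009, Thm. VI.4.1 (b)] [cite: EdixhovenManin1991, Prop. 2] -/
theorem exists_datum_padicValInt_two_c_eq_of_isIsogenous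
    (W : WeierstrassCurve ℚ) [W.IsElliptic] [W.IsGloballyMinimal] (hirr : W.HasIrreducibleModPGaloisRep 2)
    {N : ℕ} [NeZero N] (Dt : ModularParametrizationData W N)
    (W' : WeierstrassCurve ℚ) [W'.IsElliptic] [W'.IsGloballyMinimal] (D' : ModularParametrizationData W' N) (hiso : W.IsIsogenous W') :
    ∃ Dk : ModularParametrizationData W N, Dk.f = Dt.f ∧ padicValInt 2 Dk.c = padicValInt 2 D'.c := by
  obtain ⟨Dk, μ, hfk, -, -, hμ, hck⟩ := exists_datum_c_eq_odd_mul_of_isIsogenous W hirr Dt W' D' hiso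
  refine ⟨Dk, hfk, ?_⟩
  have hμ0 : μ ≠ 0 := by rintro rfl; exact (Int.not_even_iff_odd.mpr hμ) ⟨0, by norm_num⟩
  have hμ2 : padicValInt 2 μ = 0 :=
    padicValInt.eq_zero_of_not_dvd fun h ↦ (Int.not_even_iff_odd.mpr hμ) (even_iff_two_dvd.mpr (by exact_mod_cast h))
  have hc' : D'.c ≠ 0 := D'.maninConstant_ne_zero_holds
  rw [hck, padicValInt.mul hμ0 hc', hμ2, zero_add]

/-! ## §3 The pin: «some datum of `W` has odd `c`» ⟺ «the optimal `c₀` is odd» -/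

/-- **★★ THE MANIN STUB PINNED.**  `W/ℚ` globally minimal elliptic with `E[2]` irreducible carrying a datum `Dt` at level `N`; `(W₀, D₀)` a globally
minimal lattice-optimal datum of the class at level `N` (a minimal model of the strong Weil curve with its optimal parametrisation, `c₀ = D₀.c` the
Manin constant; one exists by Edixhoven's Prop. 2, `ModularParametrizationData.exists_optimalDatum_of_edixhoven`).  Then
`(∃ Dk : ModularParametrizationData W N, Odd Dk.c) ↔ Odd D₀.c`.  Unconditional.  READING for LINE 23: the stub MANIN|₄ (`OddCutManinResidueAtTwo`) is,
curve by curve, EXACTLY Manin's conjecture modulo `2` for the optimal curve of the class — no non-optimal parametrisation can rescue an even `c₀`.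
[cite: SilvermanAEC2009, Thm. VI.4.1 (b), Cor. III.4.11] [cite: EdixhovenManin1991, Prop. 2] [cite: AgasheRibetStein2006, §2, Thm. 2.2] -/
theorem exists_datum_odd_c_iff_odd_optimal_c
    (W : WeierstrassCurve ℚ) [W.IsElliptic] [W.IsGloballyMinimal] (hirr : W.HasIrreducibleModPGaloisRep 2)
    {N : ℕ} [NeZero N] (Dt : ModularParametrizationData W N)
    (W₀ : WeierstrassCurve ℚ) [W₀.IsElliptic] [W₀.IsGloballyMinimal] (D₀ : ModularParametrizationData W₀ N)
    (hiso : W.IsIsogenous W₀) (hopt : ∀ z ∈ D₀.L.lattice, ∃ w ∈ periodLattice D₀.f, z = (D₀.c : ℂ) * w) :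
    (∃ Dk : ModularParametrizationData W N, Odd Dk.c) ↔ Odd D₀.c :=
  ⟨fun ⟨Dk, hk⟩ ↦ odd_optimal_c_of_odd_c W hirr Dk hk W₀ D₀ hiso hopt,
    fun h ↦ let ⟨Dk, _, _, _, hk⟩ := exists_datum_odd_c_of_isIsogenous_odd_c W hirr Dt W₀ D₀ hiso h; ⟨Dk, hk⟩⟩

/-- **The minimum `2`-adic valuation of Manin constants of `W` at level `N` is `v₂(c₀)`**: some datum attains `v₂(c₀)` and none goes below.
Unconditional. [cite: SilvermanAEC2009, Thm. VI.4.1 (b)] [cite: EdixhovenManin1991, Prop. 2] -/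
theorem isLeast_padicValInt_two_c_optimal
    (W : WeierstrassCurve ℚ) [W.IsElliptic] [W.IsGloballyMinimal] (hirr : W.HasIrreducibleModPGaloisRep 2)
    {N : ℕ} [NeZero N] (Dt : ModularParametrizationData W N)
    (W₀ : WeierstrassCurve ℚ) [W₀.IsElliptic] [W₀.IsGloballyMinimal] (D₀ : ModularParametrizationData W₀ N)
    (hiso : W.IsIsogenous W₀) (hopt : ∀ z ∈ D₀.L.lattice, ∃ w ∈ periodLattice D₀.f, z = (D₀.c : ℂ) * w) :
    IsLeast {v : ℕ | ∃ Dk : ModularParametrizationData W N, padicValInt 2 Dk.c = v} (padicValInt 2 D₀.c) := by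
  refine ⟨?_, fun v ⟨Dk, hv⟩ ↦ hv ▸ padicValInt_two_optimal_c_le W hirr Dk W₀ D₀ hiso hopt⟩
  obtain ⟨Dk, -, hk⟩ := exists_datum_padicValInt_two_c_eq_of_isIsogenous W hirr Dt W₀ D₀ hiso
  exact ⟨Dk, hk⟩

/-! ## §4 In LINE 23's currency: MANIN|₄ at `W` ⟺ the optimal Manin constant of `W`'s class is odd -/

/-- **MANIN|₄, curve by curve, is Manin's conjecture mod `2` for the strong Weil curve.**  For `W/ℚ` globally minimal with `ρ_{W,2^n}` onto for all
`n ≥ 1` (the odd habitat cut's image hypothesis; only `n = 1`, i.e. `E[2]` irreducible, is used), granted the modularity fact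
`nonempty_modularParametrizationData` (BCDT: a datum of `W` at level `N_W` exists): `W` has SOME datum at level `N_W` with odd Manin constant —
the `W`-instance of `OddCutManinResidueAtTwo` — IFF every globally minimal lattice-optimal datum `(W₀, D₀)` at level `N_W` in `W`'s isogeny class has
odd `D₀.c` (such `(W₀, D₀)` exist by Edixhoven's Prop. 2, a tree theorem, so the right side is not vacuous).  The other cut hypotheses of MANIN|₄
(`r_an = 1`, `#Sel₂ = 2`, odd Tamagawa product, an odd multiplicative prime, `4 ∣ N_W`) are idle for this equivalence.  CONDITIONAL on
modularity only; BSD is NOT proved; MANIN|₄ is NOT proved. [cite: EdixhovenManin1991, Prop. 2] [cite: AgasheRibetStein2006, Thm. 2.2]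
[cite: BCDTJAMS2001, Thm. A] -/
theorem exists_datum_odd_c_conductor_iff_forall_optimal_odd (hmodD : nonempty_modularParametrizationData)
    (W : WeierstrassCurve ℚ) [W.IsElliptic] [W.IsGloballyMinimal] [NeZero (W.conductorNorm ℤ)]
    (hρ : ∀ n : ℕ, 0 < n → W.HasSurjectiveModNGaloisRep ((2 : ℤ) ^ n)) :
    (∃ Dt : ModularParametrizationData W (W.conductorNorm ℤ), Odd Dt.c) ↔
      ∀ (W₀ : WeierstrassCurve ℚ) [W₀.IsElliptic] [W₀.IsGloballyMinimal] (D₀ : ModularParametrizationData W₀ (W.conductorNorm ℤ)),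
        W.IsIsogenous W₀ → (∀ z ∈ D₀.L.lattice, ∃ w ∈ periodLattice D₀.f, z = (D₀.c : ℂ) * w) → Odd D₀.c := by
  have hirr := hasIrreducibleModPGaloisRep_two_of_forall_hasSurjectiveModNGaloisRep W hρ
  refine ⟨fun ⟨Dt, hodd⟩ W₀ _ _ D₀ hiso hopt ↦ odd_optimal_c_of_odd_c W hirr Dt hodd W₀ D₀ hiso hopt, fun h ↦ ?_⟩
  obtain ⟨D⟩ := hmodD W
  obtain ⟨W₀, hW₀, hW₀', D₀, -, hiso, hopt, -⟩ := D.exists_optimalDatum_of_edixhoven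
    (fun hf' hL' q hq hq' ↦ edixhoven_int_of_neronLattice_eq_smul_periodLattice_holds hf' hL' q hq hq')
  obtain ⟨Dk, -, -, -, hk⟩ := exists_datum_odd_c_of_isIsogenous_odd_c W hirr D W₀ D₀ hiso (h W₀ D₀ hiso hopt)
  exact ⟨Dk, hk⟩

/-- **The same in U₂'s own hypotheses** (analytic rank `1`, `#Sel₂(W) = 2` ⟹ `E[2]` irreducible, via GZK for the rank): `W` has a datum at level
`N_W` with odd Manin constant iff every globally minimal lattice-optimal datum of its class at level `N_W` has odd Manin constant.  CONDITIONAL on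
modularity + GZK; BSD is NOT proved. [cite: EdixhovenManin1991, Prop. 2] [cite: AgasheRibetStein2006, Thm. 2.2] -/
theorem exists_datum_odd_c_conductor_iff_forall_optimal_odd_of_analyticRank_one (hmodD : nonempty_modularParametrizationData)
    (hGZK : rank_eq_analyticRank_of_analyticRank_le_one)
    (W : WeierstrassCurve ℚ) [W.IsElliptic] [W.IsGloballyMinimal] [NeZero (W.conductorNorm ℤ)] (hr : W.analyticRank = 1)
    (hSel : Nat.card (W.selmerGroup 2) = 2) :
    (∃ Dt : ModularParametrizationData W (W.conductorNorm ℤ), Odd Dt.c) ↔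
      ∀ (W₀ : WeierstrassCurve ℚ) [W₀.IsElliptic] [W₀.IsGloballyMinimal] (D₀ : ModularParametrizationData W₀ (W.conductorNorm ℤ)),
        W.IsIsogenous W₀ → (∀ z ∈ D₀.L.lattice, ∃ w ∈ periodLattice D₀.f, z = (D₀.c : ℂ) * w) → Odd D₀.c := by
  have hirr := hasIrreducibleModPGaloisRep_two_of_analyticRank_one_of_natCard_selmerGroup_two hGZK W hr hSel
  refine ⟨fun ⟨Dt, hodd⟩ W₀ _ _ D₀ hiso hopt ↦ odd_optimal_c_of_odd_c W hirr Dt hodd W₀ D₀ hiso hopt, fun h ↦ ?_⟩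
  obtain ⟨D⟩ := hmodD W
  obtain ⟨W₀, hW₀, hW₀', D₀, -, hiso, hopt, -⟩ := D.exists_optimalDatum_of_edixhoven
    (fun hf' hL' q hq hq' ↦ edixhoven_int_of_neronLattice_eq_smul_periodLattice_holds hf' hL' q hq hq')
  obtain ⟨Dk, -, -, -, hk⟩ := exists_datum_odd_c_of_isIsogenous_odd_c W hirr D W₀ D₀ hiso (h W₀ D₀ hiso hopt)
  exact ⟨Dk, hk⟩

end Summit.BirchSwinnertonDyer.BirchSwinnertonDyer.Theorems.GenusExact.TwinSwap.OddManin

end
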